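import Literature.Topology.FourManifolds.LatticeFormsOrientationCharacterDeterminant
import Literature.Topology.FourManifolds.LatticeFormsWallGenerators
import Literature.Topology.FourManifolds.LatticeFormsDiscriminantFormIsometry
import Literature.LinearAlgebra.QuadraticForm.CartanDieudonne
import HarnessLib

/-!
# Eichler transvections lie in `S̃O⁺(L)`: `t(e,a) ∈ Õ(L) ∩ O⁺(L) ∩ O⁺(L(−1))`, `det t(e,a) = 1`, and
# `t(e,a) = σ_a σ_{a + ½(a,a) e}` (Gritsenko–Hulek–Sankaran, *J. Algebra* 322 (2009) §3.1, (t2), (t6), (8))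

Trunk T-4MAN vocabulary. Sequel of `LatticeFormsTransvections.lean` (the Eichler transvection
`B.eichlerTransvection e a q : v ↦ v + B(e,v) a − B(a,v) e − q B(e,v) e` over any commutative ring, its composition law,
the bundled isometry `IsometryEquiv.eichlerTransvection` for `B(e,e) = B(e,a) = 0`, `B(a,a) = 2q`), of
`LatticeFormsWallGenerators.lean` (Kirby's `A_w = E(y, w, q)`, `A'_w = E(x, w, q)` on `Q ⊕ H`), of
`LatticeFormsOrientationCharacter(Determinant).lean` (`O⁺(L)`, `O⁺(L(−1))`, `det`, realisation of record `realForm Q`,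
`realEnd`) and of `LatticeFormsDiscriminantFormIsometry.lean` (`γ̄ = γ.discriminantGroupCongr` on `A_L`). Written for lane
`lit-hodgefound` (Track 2 foundations; prover seat `lit-hodgefound-p18`, gen 48, row g48-#8). THEOREMS ONLY — no
definition, no named fact, no instance, no notation.

## Source, verbatim

V. Gritsenko, K. Hulek, G. K. Sankaran, *Abelianisation of orthogonal groups and the fundamental group of modular
varieties*, J. Algebra 322 (2009) 463–478 [`GritsenkoHulekSankaran2009`, held `paper:arxiv-0810.1614`], §3 (p. 3): "any
`g ∈ O(L ⊗ K)` can be represented as the product of reflections `g = σ_{v_1}σ_{v_2}…σ_{v_m}` […] We define the spinor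
norm over `K` as follows: `sn_K(g) = (−(v_1,v_1)/2)·…·(−(v_m,v_m)/2)(K^×)²`. […] We have made this choice `−( , )` […]
because […] reflection with respect to a vector with negative norm fixes the connected component of the homogeneous
domains. […] `O⁺(L) = O(L) ∩ ker sn_ℝ`, `Õ⁺(L) = Õ(L) ∩ O⁺(L)` […] `SO⁺(L) = O⁺(L) ∩ SO(L)` and
`S̃O⁺(L) = Õ⁺(L) ∩ SO(L)`"; §3.1 (p. 6): "the map `t(e, a) : v ↦ v − (a,v)e + (e,v)a − ½(a,a)(e,v)e` **(t2)** […]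
**(t6)** `t(e,a) = σ_a σ_{a + ½(a,a)e}` if `(a,a) ≠ 0`. […] From the definition (t2) we see that any transvection
`t(e,a)` is unipotent. From equation (t6) we have that `t(e,a) ∈ SO⁺(L ⊗ ℚ)`. According to equation (t2) **(8)**
`t(e,a) ∈ S̃O⁺(L)` for any `e ∈ L`, `a ∈ L` with `(e,e) = (e,a) = 0`."

## Contents (all proved) and reading notes

* §1 over a field `K` with `2 ≠ 0`: **(t6)** `E(e,a,q) = τ_a ∘ τ_{a + q e}` for `B(a,a) = 2q ≠ 0`
  (`eichlerTransvection_eq_reflection_mul_reflection`; the tree's reflection `QuadraticForm.reflection`).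
* §2 over `ℝ` (`S` symmetric non-degenerate on a finite-dimensional normed space): `E(e,a,q) ∈ O⁺(S)`, `∈ O⁺(−S)`,
  `det = 1` (`isOrientationPreserving_toContinuousLinearMap_eichlerTransvection`, `…_neg_…`,
  `det_toContinuousLinearMap_eichlerTransvection`). PROOF NOTE: instead of
  (t6), which needs `(a,a) ≠ 0`, the file uses the composition law `E(e,a,q) = E(e, a/2, q/4)²` and the character
  property (`g² ∈ O⁺` for every isometry `g`), which covers isotropic `a` as well — a genuinely shorter road to the
  printed conclusion "`t(e,a) ∈ SO⁺(L ⊗ ℚ)`" (read over `ℝ`; "unipotent" gives `det = 1`, here `det = χ₊ χ₋`).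
* §3 lattices (`Q` symmetric non-degenerate on a finite free `ℤ`-module): `t(e,a) ⊗ ℝ` is the real transvection
  (`realEnd_eichlerTransvection`), hence **`t(e,a) ∈ O⁺(L)`**, **`∈ O⁺(L(−1))`**, **`det t(e,a) = 1`**; and **(t2) ⟹
  `t(e,a) ∈ Õ(L)`** (`discriminantGroupCongr_eichlerTransvection`: for `φ ∈ L^*`,
  `φ ∘ t(e,a)⁻¹ − φ = (y, ·)` with `y = φ(e) a − (φ(a) + q φ(e)) e ∈ L`) — together **(8) `t(e,a) ∈ S̃O⁺(L)`**
  (`eichlerTransvection_mem_stableSpecialOrthogonal`, a conjunction; no subgroup is formed).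
* §4 Kirby's generators `A_w`, `A'_w` of `O(Q ⊕ H)` (`transvectionAEquiv`, `transvectionA'Equiv`) lie in `S̃O⁺(Q ⊕ H)`.

NOT here: "`t(e, *) : e^⊥_L → S̃O⁺(L)` is a homomorphism with kernel `ℤe`" (the composition law is
`eichlerTransvection_comp`; the kernel statement is not formalised), `E_U(L₁) = ⟨t(e,a), t(f,a)⟩` as a subgroup.
-/

noncomputable section

open Module
open LinearMap (BilinForm)
open Literature.LinearAlgebra.QuadraticForm Literature.Topology.FourManifolds

namespace LinearMap.BilinForm

/-! ### §1 (t6): `E(e,a,q) = τ_a τ_{a + q e}` over a field -/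

section Field

variable {K : Type*} [Field K] {W : Type*} [AddCommGroup W] [Module K W] (B : BilinForm K W)

/-- **(t6) `t(e,a) = σ_a σ_{a + ½(a,a) e}` for `(a,a) ≠ 0`**: over a field with `2 ≠ 0`, for `e` isotropic, `a ⊥ e`
and `B(a,a) = 2q ≠ 0`, the Eichler transvection `E(e,a,q)` is the product of the reflections along `a` and along
`a + q e` (two vectors of the same square `2q`). [cite: GritsenkoHulekSankaran2009, §3.1 (t6)] -/
theorem eichlerTransvection_eq_reflection_mul_reflection [NeZero (2 : K)] (hB : B.IsSymm) {e a : W}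
    (he : B e e = 0) (hea : B e a = 0) {q : K} (hq : B a a = q + q) (hq0 : q ≠ 0) :
    B.eichlerTransvection e a q = reflection B a * reflection B (a + q • e) := by
  have hae : B a e = 0 := by rw [hB.eq, hea]
  have h2 : (2 : K) / (q + q) = q⁻¹ := by
    rw [← two_mul]
    field_simp
  have ha' : B (a + q • e) (a + q • e) = q + q := by
    simp only [map_add, map_smul, LinearMap.add_apply, LinearMap.smul_apply, smul_eq_mul, hq, hae, hea, he]
    ring
  ext v
  rw [Module.End.mul_apply, Literature.LinearAlgebra.QuadraticForm.reflection_apply,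
    Literature.LinearAlgebra.QuadraticForm.reflection_apply, ha', hq, h2, LinearMap.BilinForm.eichlerTransvection_apply]
  simp only [map_add, map_sub, map_smul, LinearMap.add_apply, LinearMap.smul_apply, smul_eq_mul, hq, hae, smul_add,
    smul_smul]
  match_scalars <;> field_simp <;> ring

end Field

/-! ### §2 Over `ℝ`: `E(e,a,q) ∈ O⁺(S) ∩ O⁺(−S)`, `det = 1` -/

section Real

variable {W : Type*} [NormedAddCommGroup W] [NormedSpace ℝ W] [FiniteDimensional ℝ W] {S : BilinForm ℝ W}

/-- `LinearMap.toContinuousLinearMap` is multiplicative (plumbing). [folklore] -/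
private theorem toCLM_mul (f g : Module.End ℝ W) :
    LinearMap.toContinuousLinearMap (f * g) =
      LinearMap.toContinuousLinearMap f * LinearMap.toContinuousLinearMap g :=
  rfl

omit [FiniteDimensional ℝ W] in
/-- **`E(e,a,q) = E(e, a/2, q/4)²`** (composition law: `E(e,b,q') E(e,b,q') = E(e, 2b, 2q' + S(b,b))`, and
`S(a/2, a/2) = q/2` when `S(a,a) = 2q`). [cite: GritsenkoHulekSankaran2009, §3.1 (t3)–(t5) (composition of transvections)] -/
theorem eichlerTransvection_eq_half_mul_half (hS : S.IsSymm) {e a : W} (he : S e e = 0) (hea : S e a = 0) {q : ℝ}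
    (hq : S a a = q + q) :
    S.eichlerTransvection e a q =
      S.eichlerTransvection e ((1 / 2 : ℝ) • a) (q / 4) * S.eichlerTransvection e ((1 / 2 : ℝ) • a) (q / 4) := by
  have hea' : S e ((1 / 2 : ℝ) • a) = 0 := by rw [map_smul, smul_eq_mul, hea, mul_zero]
  rw [Module.End.mul_eq_comp, eichlerTransvection_comp S hS he hea' hea']
  congr 1
  · rw [← add_smul]
    norm_num
  · simp only [map_smul, LinearMap.smul_apply, smul_eq_mul, hq]
    ring

omit [FiniteDimensional ℝ W] in
/-- The half transvection `E(e, a/2, q/4)` is an isometry of `S` (`S(a/2,a/2) = 2 · (q/4)`). [cite: GritsenkoHulekSankaran2009, §3.1 (t2)] -/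
theorem apply_eichlerTransvection_half (hS : S.IsSymm) {e a : W} (he : S e e = 0) (hea : S e a = 0) {q : ℝ}
    (hq : S a a = q + q) (v w : W) :
    S (S.eichlerTransvection e ((1 / 2 : ℝ) • a) (q / 4) v) (S.eichlerTransvection e ((1 / 2 : ℝ) • a) (q / 4) w) =
      S v w := by
  have hea' : S e ((1 / 2 : ℝ) • a) = 0 := by rw [map_smul, smul_eq_mul, hea, mul_zero]
  rw [map_eichlerTransvection S hS he hea']
  simp only [map_smul, LinearMap.smul_apply, smul_eq_mul, hq]
  ring

omit [FiniteDimensional ℝ W] in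
/-- `E(e,a,q)` is an isometry of `S` (`S(a,a) = 2q`). [cite: GritsenkoHulekSankaran2009, §3.1 (t2)] -/
theorem apply_eichlerTransvection (hS : S.IsSymm) {e a : W} (he : S e e = 0) (hea : S e a = 0) {q : ℝ}
    (hq : S a a = q + q) (v w : W) :
    S (S.eichlerTransvection e a q v) (S.eichlerTransvection e a q w) = S v w := by
  rw [map_eichlerTransvection S hS he hea, hq, sub_self, mul_zero, add_zero]

/-- **`t(e,a) ∈ O⁺(L ⊗ ℝ)`: an Eichler transvection preserves the orientation of the positive definite part** (`S`
symmetric non-degenerate): it is the square of the isometry `E(e, a/2, q/4)`, and squares lie in the kernel of the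
orientation character. [cite: GritsenkoHulekSankaran2009, §3.1 ("t(e,a) ∈ SO⁺(L ⊗ ℚ)")] -/
theorem isOrientationPreserving_toContinuousLinearMap_eichlerTransvection (hS : S.IsSymm) (hnd : S.Nondegenerate) {e a : W}
    (he : S e e = 0) (hea : S e a = 0) {q : ℝ} (hq : S a a = q + q) :
    IsOrientationPreserving S (LinearMap.toContinuousLinearMap (S.eichlerTransvection e a q)) := by
  obtain ⟨P, hP⟩ := exists_isPosProjection hS hnd
  have hh : ∀ x y, S (LinearMap.toContinuousLinearMap (S.eichlerTransvection e ((1 / 2 : ℝ) • a) (q / 4)) x)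
      (LinearMap.toContinuousLinearMap (S.eichlerTransvection e ((1 / 2 : ℝ) • a) (q / 4)) y) = S x y :=
    fun x y ↦ apply_eichlerTransvection_half hS he hea hq x y
  rw [eichlerTransvection_eq_half_mul_half hS he hea hq, toCLM_mul]
  exact (hP.isOrientationPreserving_mul_iff hS (pos_apply_of_isometry hh) (pos_apply_of_isometry hh)).2 Iff.rfl

/-- **`t(e,a) ∈ O⁺(−S)` as well**: an Eichler transvection preserves the orientation of the negative definite part
(same argument for `−S`, of which it is also an isometry). [cite: GritsenkoHulekSankaran2009, §3.1 ("t(e,a) ∈ SO⁺(L ⊗ ℚ)"; "the different spinor norms agree on SO")] -/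
theorem isOrientationPreserving_neg_toContinuousLinearMap_eichlerTransvection (hS : S.IsSymm) (hnd : S.Nondegenerate) {e a : W}
    (he : S e e = 0) (hea : S e a = 0) {q : ℝ} (hq : S a a = q + q) :
    IsOrientationPreserving (-S) (LinearMap.toContinuousLinearMap (S.eichlerTransvection e a q)) := by
  obtain ⟨P, hP⟩ := exists_isPosProjection hS hnd
  have hh0 : ∀ x y, S (LinearMap.toContinuousLinearMap (S.eichlerTransvection e ((1 / 2 : ℝ) • a) (q / 4)) x)
      (LinearMap.toContinuousLinearMap (S.eichlerTransvection e ((1 / 2 : ℝ) • a) (q / 4)) y) = S x y :=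
    fun x y ↦ apply_eichlerTransvection_half hS he hea hq x y
  have hh : ∀ x y, (-S) (LinearMap.toContinuousLinearMap (S.eichlerTransvection e ((1 / 2 : ℝ) • a) (q / 4)) x)
      (LinearMap.toContinuousLinearMap (S.eichlerTransvection e ((1 / 2 : ℝ) • a) (q / 4)) y) = (-S) x y :=
    fun x y ↦ by simp only [LinearMap.neg_apply, hh0]
  rw [eichlerTransvection_eq_half_mul_half hS he hea hq, toCLM_mul]
  exact (hP.one_sub.isOrientationPreserving_mul_iff hS.neg (pos_apply_of_isometry hh)
    (pos_apply_of_isometry hh)).2 Iff.rfl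

/-- **"any transvection `t(e,a)` is unipotent"**, in the form used here: `det E(e,a,q) = 1` (`det = χ₊ χ₋`).
[cite: GritsenkoHulekSankaran2009, §3.1 ("t(e,a) is unipotent … t(e,a) ∈ SO⁺(L ⊗ ℚ)")] -/
theorem det_toContinuousLinearMap_eichlerTransvection (hS : S.IsSymm) (hnd : S.Nondegenerate) {e a : W} (he : S e e = 0)
    (hea : S e a = 0) {q : ℝ} (hq : S a a = q + q) :
    (LinearMap.toContinuousLinearMap (S.eichlerTransvection e a q)).det = 1 :=
  det_eq_one_of_isOrientationPreserving_of_neg hS hnd (fun x y ↦ apply_eichlerTransvection hS he hea hq x y)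
    (isOrientationPreserving_toContinuousLinearMap_eichlerTransvection hS hnd he hea hq)
    (isOrientationPreserving_neg_toContinuousLinearMap_eichlerTransvection hS hnd he hea hq)

end Real

/-! ### §3 Lattices: `t(e,a) ∈ S̃O⁺(L)` -/

section Lattice

universe u

variable {L : Type u} [AddCommGroup L] [Module.Finite ℤ L] [Module.Free ℤ L] (Q : BilinForm ℤ L)

/-- `bᵢ ⊗ 1 = eᵢ`: the coordinates of a basis vector of record (plumbing). [folklore] -/
private theorem coords_basis (i : Module.Free.ChooseBasisIndex ℤ L) :
    (fun k ↦ (((Module.Free.chooseBasis ℤ L).repr (Module.Free.chooseBasis ℤ L i)) k : ℝ)) =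
      Pi.basisFun ℝ (Module.Free.ChooseBasisIndex ℤ L) i := by
  ext k
  by_cases h : k = i
  · subst h
    simp
  · simp [h]

/-- `(f ⊗ ℝ)(eᵢ) = f(bᵢ) ⊗ 1` (plumbing). [folklore] -/
private theorem realEnd_basisFun' (f : L →ₗ[ℤ] L) (i : Module.Free.ChooseBasisIndex ℤ L) :
    realEnd f (Pi.basisFun ℝ (Module.Free.ChooseBasisIndex ℤ L) i) =
      fun k ↦ (((Module.Free.chooseBasis ℤ L).repr (f (Module.Free.chooseBasis ℤ L i))) k : ℝ) := by
  rw [realEnd_apply, realMap_basis]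
  ext j
  simp [Finset.sum_apply, Pi.basisFun_apply, Pi.single_apply]

/-- **`t(e,a) ⊗ ℝ` is the real Eichler transvection** `E(e ⊗ 1, a ⊗ 1, q)` of `Q ⊗ ℝ`, in the coordinates of record.
[cite: GritsenkoHulekSankaran2009, §3.1 (t2) ("t(e,a) ∈ SO⁺(L ⊗ ℚ)")] -/
theorem realEnd_eichlerTransvection (e a : L) (q : ℤ) :
    realEnd (Q.eichlerTransvection e a q) = LinearMap.toContinuousLinearMap
      ((realForm Q).eichlerTransvection (fun i ↦ ((Module.Free.chooseBasis ℤ L).repr e i : ℝ))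
        (fun i ↦ ((Module.Free.chooseBasis ℤ L).repr a i : ℝ)) (q : ℝ)) := by
  apply ContinuousLinearMap.coe_injective
  rw [LinearMap.coe_toContinuousLinearMap]
  refine (Pi.basisFun ℝ (Module.Free.ChooseBasisIndex ℤ L)).ext fun i ↦ ?_
  rw [ContinuousLinearMap.coe_coe, realEnd_basisFun', ← coords_basis i, LinearMap.BilinForm.eichlerTransvection_apply,
    LinearMap.BilinForm.eichlerTransvection_apply, realForm_coord, realForm_coord]
  ext k
  simp only [map_add, map_sub, map_smul, Finsupp.coe_add, Finsupp.coe_sub, Finsupp.coe_smul, Pi.add_apply,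
    Pi.sub_apply, Pi.smul_apply, smul_eq_mul, Int.cast_add, Int.cast_sub, Int.cast_mul]

variable {Q}

/-- `(Q ⊗ ℝ)` vanishes / takes the prescribed values on the realised vectors (plumbing). [folklore] -/
private theorem realForm_coord_eq_zero {x y : L} (h : Q x y = 0) :
    realForm Q (fun i ↦ ((Module.Free.chooseBasis ℤ L).repr x i : ℝ))
      (fun i ↦ ((Module.Free.chooseBasis ℤ L).repr y i : ℝ)) = 0 := by
  rw [realForm_coord, h, Int.cast_zero]

/-- `(Q ⊗ ℝ)(a ⊗ 1, a ⊗ 1) = q + q` when `Q(a,a) = q + q` (plumbing). [folklore] -/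
private theorem realForm_coord_eq_add {a : L} {q : ℤ} (h : Q a a = q + q) :
    realForm Q (fun i ↦ ((Module.Free.chooseBasis ℤ L).repr a i : ℝ))
      (fun i ↦ ((Module.Free.chooseBasis ℤ L).repr a i : ℝ)) = (q : ℝ) + q := by
  rw [realForm_coord, h, Int.cast_add]

omit [Module.Finite ℤ L] [Module.Free ℤ L] in
/-- The underlying linear map of the isometry `E(e,a,q)` is the transvection (plumbing). [folklore] -/
private theorem IsometryEquiv.coe_eichlerTransvection (hQ : Q.IsSymm) (e a : L) (q : ℤ) (he : Q e e = 0)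
    (hea : Q e a = 0) (hq : Q a a = q + q) :
    ((IsometryEquiv.eichlerTransvection Q hQ e a q he hea hq : Q.IsometryEquiv Q) : L →ₗ[ℤ] L) =
      Q.eichlerTransvection e a q :=
  LinearMap.ext fun _ ↦ rfl

variable (Q)

/-- **`t(e,a) ∈ O⁺(L)`**: an Eichler transvection of an integral lattice (`Q` symmetric non-degenerate, `(e,e) =
(e,a) = 0`, `(a,a) = 2q`) preserves the orientation of the positive directions of `L ⊗ ℝ` — it has real spinor norm
`sn_ℝ = 1`. [cite: GritsenkoHulekSankaran2009, §3.1 (8) ("t(e,a) ∈ S̃O⁺(L)")] -/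
theorem IsometryEquiv.isOrientationPreserving_eichlerTransvection (hQ : Q.IsSymm) (hnd : Q.Nondegenerate) (e a : L)
    (q : ℤ) (he : Q e e = 0) (hea : Q e a = 0) (hq : Q a a = q + q) :
    (IsometryEquiv.eichlerTransvection Q hQ e a q he hea hq).IsOrientationPreserving := by
  rw [IsometryEquiv.isOrientationPreserving_iff, IsometryEquiv.coe_eichlerTransvection, realEnd_eichlerTransvection]
  exact isOrientationPreserving_toContinuousLinearMap_eichlerTransvection (isSymm_realForm Q hQ)
    (nondegenerate_realForm Q hnd)
    (realForm_coord_eq_zero he) (realForm_coord_eq_zero hea) (realForm_coord_eq_add hq)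

/-- **`t(e,a) ⊗ ℝ ∈ O⁺(L(−1))`**: an Eichler transvection also preserves the orientation of the negative directions
("the different spinor norms agree on `SO(L ⊗ ℚ)`"). [cite: GritsenkoHulekSankaran2009, §3 and §3.1 (8)] -/
theorem IsometryEquiv.isOrientationPreserving_realForm_neg_eichlerTransvection (hQ : Q.IsSymm)
    (hnd : Q.Nondegenerate) (e a : L) (q : ℤ) (he : Q e e = 0) (hea : Q e a = 0) (hq : Q a a = q + q) :
    Literature.LinearAlgebra.QuadraticForm.IsOrientationPreserving (realForm (-Q))
      (realEnd ((IsometryEquiv.eichlerTransvection Q hQ e a q he hea hq : Q.IsometryEquiv Q) : L →ₗ[ℤ] L)) := by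
  rw [realForm_neg, IsometryEquiv.coe_eichlerTransvection, realEnd_eichlerTransvection]
  exact isOrientationPreserving_neg_toContinuousLinearMap_eichlerTransvection (isSymm_realForm Q hQ)
    (nondegenerate_realForm Q hnd)
    (realForm_coord_eq_zero he) (realForm_coord_eq_zero hea) (realForm_coord_eq_add hq)

/-- **`det t(e,a) = 1`** ("any transvection `t(e,a)` is unipotent"): Eichler transvections lie in `SO(L)`.
[cite: GritsenkoHulekSankaran2009, §3.1 ("t(e,a) is unipotent"; (8))] -/
theorem IsometryEquiv.det_eichlerTransvection (hQ : Q.IsSymm) (hnd : Q.Nondegenerate) (e a : L) (q : ℤ)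
    (he : Q e e = 0) (hea : Q e a = 0) (hq : Q a a = q + q) :
    LinearMap.det ((IsometryEquiv.eichlerTransvection Q hQ e a q he hea hq : Q.IsometryEquiv Q) : L →ₗ[ℤ] L) = 1 :=
  IsometryEquiv.det_eq_one_of_isOrientationPreserving Q hQ hnd _
    (IsometryEquiv.isOrientationPreserving_eichlerTransvection Q hQ hnd e a q he hea hq)
    (IsometryEquiv.isOrientationPreserving_realForm_neg_eichlerTransvection Q hQ hnd e a q he hea hq)

omit [Module.Finite ℤ L] [Module.Free ℤ L] in
/-- **(t2) ⟹ `t(e,a) ∈ Õ(L)`: an Eichler transvection acts trivially on the discriminant group `A_L = L^*/L`** (any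
integral lattice, `Q` symmetric): for `φ ∈ L^*`, `φ ∘ t(e,a)⁻¹ − φ = φ ∘ t(e,−a) − φ = (y, ·)` with
`y = φ(e) a − (φ(a) + q φ(e)) e ∈ L`. [cite: GritsenkoHulekSankaran2009, §3.1 (t2), (8) ("According to equation (t2) t(e,a) ∈ S̃O⁺(L)")] -/
theorem IsometryEquiv.discriminantGroupCongr_eichlerTransvection (hQ : Q.IsSymm) (e a : L) (q : ℤ)
    (he : Q e e = 0) (hea : Q e a = 0) (hq : Q a a = q + q) :
    (IsometryEquiv.eichlerTransvection Q hQ e a q he hea hq).discriminantGroupCongr =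
      LinearEquiv.refl ℤ Q.discriminantGroup := by
  refine LinearEquiv.ext fun x ↦ ?_
  obtain ⟨φ, rfl⟩ := Q.discriminantGroup_mk_surjective x
  rw [IsometryEquiv.discriminantGroupCongr_mk, LinearEquiv.refl_apply, Submodule.Quotient.eq]
  refine ⟨φ e • a + (-(φ a) - q * φ e) • e, LinearMap.ext fun l ↦ ?_⟩
  rw [LinearMap.sub_apply, LinearEquiv.dualMap_apply]
  change Q (φ e • a + (-(φ a) - q * φ e) • e) l = φ (Q.eichlerTransvection e (-a) q l) - φ l
  simp only [LinearMap.BilinForm.eichlerTransvection_apply, map_add, map_sub, map_smul, map_neg, LinearMap.add_apply,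
    LinearMap.smul_apply, LinearMap.neg_apply, smul_eq_mul, hQ.eq a l, hQ.eq e l]
  ring

/-- **(8) `t(e,a) ∈ S̃O⁺(L) = Õ(L) ∩ O⁺(L) ∩ SO(L)`** for every Eichler transvection of a symmetric non-degenerate integral
lattice. [cite: GritsenkoHulekSankaran2009, §3.1 (8)] -/
theorem IsometryEquiv.eichlerTransvection_mem_stableSpecialOrthogonal (hQ : Q.IsSymm) (hnd : Q.Nondegenerate) (e a : L) (q : ℤ) (he : Q e e = 0) (hea : Q e a = 0)
    (hq : Q a a = q + q) :
    (IsometryEquiv.eichlerTransvection Q hQ e a q he hea hq).discriminantGroupCongr =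
        LinearEquiv.refl ℤ Q.discriminantGroup ∧
      (IsometryEquiv.eichlerTransvection Q hQ e a q he hea hq).IsOrientationPreserving ∧
      LinearMap.det ((IsometryEquiv.eichlerTransvection Q hQ e a q he hea hq : Q.IsometryEquiv Q) : L →ₗ[ℤ] L) = 1 :=
  ⟨IsometryEquiv.discriminantGroupCongr_eichlerTransvection Q hQ e a q he hea hq,
    IsometryEquiv.isOrientationPreserving_eichlerTransvection Q hQ hnd e a q he hea hq,
    IsometryEquiv.det_eichlerTransvection Q hQ hnd e a q he hea hq⟩

end Lattice

end LinearMap.BilinForm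

/-! ### §4 Kirby's generators `A_w`, `A'_w` of `O(Q ⊕ H)` lie in `S̃O⁺(Q ⊕ H)` -/

namespace Literature.Topology.FourManifolds

open LinearMap.BilinForm

universe u

variable {V : Type u} [AddCommGroup V] [Module.Finite ℤ V] [Module.Free ℤ V] {Q : BilinForm ℤ V}

/-- **Kirby's `A_w = E(y, w, q)` lies in `S̃O⁺(Q ⊕ H)`**: it acts trivially on the discriminant group, preserves the
orientation of the positive directions, and has determinant `1` (`Q` symmetric, `Q ⊕ H` non-degenerate, `w·w = 2q`).
[cite: GritsenkoHulekSankaran2009, §3.1 (8) and Prop. 3.3 (E_U(L₁))] [cite: Kirby1989, Ch. X, proof of Thm. 2 (p. 62) (A_w)] -/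
theorem transvectionAEquiv_mem_stableSpecialOrthogonal (hQ : Q.IsSymm) (hnd : (Q.prod hyperbolicForm).Nondegenerate)
    (w : V) (q : ℤ) (hw : Q w w = q + q) :
    (transvectionAEquiv hQ w q hw).discriminantGroupCongr = LinearEquiv.refl ℤ _ ∧
      (transvectionAEquiv hQ w q hw).IsOrientationPreserving ∧
      LinearMap.det ((transvectionAEquiv hQ w q hw : (Q.prod hyperbolicForm).IsometryEquiv (Q.prod hyperbolicForm)) :
        V × (Fin 2 → ℤ) →ₗ[ℤ] V × (Fin 2 → ℤ)) = 1 :=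
  IsometryEquiv.eichlerTransvection_mem_stableSpecialOrthogonal (Q.prod hyperbolicForm) (hQ.prod isSymm_hyperbolicForm)
    hnd hypY (w, 0) q (prod_hyperbolic_hypY_hypY Q) (prod_hyperbolic_hypY_inl Q w)
    (by rw [prod_hyperbolic_inl_inl, hw])

/-- **Kirby's `A'_w = E(x, w, q)` lies in `S̃O⁺(Q ⊕ H)`.**
[cite: GritsenkoHulekSankaran2009, §3.1 (8) and Prop. 3.3] [cite: Kirby1989, Ch. X, proof of Thm. 2 (p. 62) (A'_w)] -/
theorem transvectionA'Equiv_mem_stableSpecialOrthogonal (hQ : Q.IsSymm) (hnd : (Q.prod hyperbolicForm).Nondegenerate)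
    (w : V) (q : ℤ) (hw : Q w w = q + q) :
    (transvectionA'Equiv hQ w q hw).discriminantGroupCongr = LinearEquiv.refl ℤ _ ∧
      (transvectionA'Equiv hQ w q hw).IsOrientationPreserving ∧
      LinearMap.det ((transvectionA'Equiv hQ w q hw : (Q.prod hyperbolicForm).IsometryEquiv (Q.prod hyperbolicForm)) :
        V × (Fin 2 → ℤ) →ₗ[ℤ] V × (Fin 2 → ℤ)) = 1 :=
  IsometryEquiv.eichlerTransvection_mem_stableSpecialOrthogonal (Q.prod hyperbolicForm) (hQ.prod isSymm_hyperbolicForm)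
    hnd hypX (w, 0) q (prod_hyperbolic_hypX_hypX Q) (prod_hyperbolic_hypX_inl Q w)
    (by rw [prod_hyperbolic_inl_inl, hw])

end Literature.Topology.FourManifolds
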